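import Summits.QuantumFields.YangMills.Theorems.UniversalDetectorHankelLongitudinal
import Summits.QuantumFields.YangMills.Theses.FixedTorusFirst
import HarnessLib

/-!
# Route `FixedTorusFirst`, LINE g11-2 «engine tori» — proof of the support item `TorusHankelLongitudinal`

Ideator seat ym-idea-8 (generation 11, lens «dual»); closes the support item `FixedTorusFirst.TorusHankelLongitudinal`
(stmt-QuantumFields-24176) of rung R2a (`BalabanLadder.NT`): along a torus-selection function `Lsel : ℝ → ℕ` with
`a β · Lsel β → ∞`, far-boundedness of all 36 rescaled plane kernels on the engine torus `Lsel β` (BDD6_T) implies the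
longitudinal Lipschitz modulus `|K⁶(z) − K⁶(z + n e_k)| ≤ Λ·(a n)` along axis segments that stay `η`-far from the origin
and outside the slab `|a z_k| ≥ τ` (LONG6_T).

This is a RE-WRAP of the landed per-torus proof `universalDetector_hankelLongitudinal` (LINE g10-1 «Hankel
tightness»): the unit step `abs_cov_sub_succ_axis_le_of_far` (reflection-positivity Hankel window bound) works at a fixed
`(β, L)`; the only volume input `τ/2 + 7 ≤ a β · L` is supplied by the growth of the engine tori instead of a threshold
`Λ₅ ≤ a β L`, and the BDD thresholds lose their `Λ₅` component.

HONEST FRAMING: an implication between lattice statements (BDD6_T ⇒ LONG6_T), valid for every compact group; it proves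
no summit, rung or crux; the crux `SomeTorusEdgeBit` stays open; not Clay.
Refs: Fröhlich–Israel–Lieb–Simon, Comm. Math. Phys. 62 (1978) Thm. 2.1; Osterwalder–Seiler, Ann. Phys. 110 (1978) §2.
-/

set_option autoImplicit false

noncomputable section

open MeasureTheory Filter Topology
open Literature.MathematicalPhysics.QuantumFieldTheory Literature.MathematicalPhysics.QuantumLattice
  Literature.Probability.LatticeModels
open Summit.QuantumFields.YangMills.Cruxes.OSLegsFromFemtoAndGap.DlrCollarTransfer
open Summit.QuantumFields.YangMills.Theorems.OSLegsFromFemtoAndGap (permPlane permPlane_valid)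

namespace Summit.QuantumFields.YangMills.Cruxes.FixedTorusFirstEngineTori

open Summit.QuantumFields.YangMills.Cruxes.UniversalDetectorHankel

/-- The support item `TorusHankelLongitudinal` of route `FixedTorusFirst` (stmt-QuantumFields-24176):
BDD6_T ⇒ LONG6_T. -/
theorem fixedTorusFirst_torusHankelLongitudinal :
    Summit.QuantumFields.YangMills.Theses.FixedTorusFirst.TorusHankelLongitudinal := by
  intro G _ _ _ _ hG
  letI : MeasurableSpace G := borel G
  haveI : BorelSpace G := ⟨rfl⟩
  intro r a Lsel ha hlim hgrow ker ker6 hB p q hp hq η hη τ hτ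
  simp only [ker6] at hB ⊢
  choose! C β₅ hBDD using hB
  -- eventually the engine torus is large: `τ/2 + 7 ≤ a β · Lsel β`
  obtain ⟨βg, hβg⟩ := Filter.eventually_atTop.1 (hgrow.eventually_ge_atTop (τ / 2 + 7))
  obtain ⟨βa, hβa⟩ : ∃ βa : ℝ, ∀ β, βa ≤ β → a β ≤ min (τ / 8) 1 := by
    have hpos : (0 : ℝ) < min (τ / 8) 1 := lt_min (by linarith) one_pos
    exact Filter.eventually_atTop.1 (hlim.eventually (Iic_mem_nhds hpos))
  set η₄ : ℝ := τ / 4 with hη₄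
  have hη₄pos : 0 < η₄ := by positivity
  set P : Fin 4 → Fin 4 × Fin 4 := fun k => permPlane (Equiv.swap 0 k) p with hP
  set Q : Fin 4 → Fin 4 × Fin 4 := fun k => permPlane (Equiv.swap 0 k) q with hQ
  have hPv : ∀ k, (P k).1 < (P k).2 := fun k => permPlane_valid _ hp
  have hQv : ∀ k, (Q k).1 < (Q k).2 := fun k => permPlane_valid _ hq
  set Cs : Fin 4 → ℝ := fun k =>
    |C (P k) (P k) η₄| + |C (Q k) (Q k) η₄| + 2 * |C (P k) (Q k) η₄| + 2 * |C (Q k) (P k) η₄| with hCs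
  set Bs : Fin 4 → ℝ := fun k =>
    |β₅ (P k) (P k) η₄| + |β₅ (Q k) (Q k) η₄| + |β₅ (P k) (Q k) η₄| + |β₅ (Q k) (P k) η₄| with hBs
  have hCs0 : ∀ k, 0 ≤ Cs k := fun k => by positivity
  have hBs0 : ∀ k, 0 ≤ Bs k := fun k => by positivity
  refine ⟨12 / τ * ∑ k, Cs k, |βa| + |βg| + ∑ k, Bs k, ?_⟩
  intro β hβ k z n hseg
  set L : ℕ := Lsel β with hLdef
  have haβ := ha β
  have hBsum : Bs k ≤ ∑ k', Bs k' := Finset.single_le_sum (fun i _ => hBs0 i) (Finset.mem_univ k)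
  have hCsum : Cs k ≤ ∑ k', Cs k' := Finset.single_le_sum (fun i _ => hCs0 i) (Finset.mem_univ k)
  have hBall : 0 ≤ ∑ k', Bs k' := Finset.sum_nonneg fun i _ => hBs0 i
  have hCall : 0 ≤ ∑ k', Cs k' := Finset.sum_nonneg fun i _ => hCs0 i
  have hβa' : βa ≤ β := by linarith [le_abs_self βa, abs_nonneg βg]
  obtain ⟨haτ8, ha1⟩ := le_min_iff.1 (hβa β hβa')
  have hβ0 : 0 ≤ β := by linarith [abs_nonneg βa, abs_nonneg βg]
  have haL : τ / 2 + 7 ≤ a β * L := hβg β (by linarith [le_abs_self βg, abs_nonneg βa])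
  have hL1 : 1 ≤ L := by
    rcases Nat.eq_zero_or_pos L with h0 | hpos
    · rw [h0] at haL; simp only [Nat.cast_zero, mul_zero] at haL; linarith
    · exact hpos
  -- far-box bounds in covariance letters
  have far : ∀ p' q' : Fin 4 × Fin 4, p'.1 < p'.2 → q'.1 < q'.2 → β₅ p' q' η₄ ≤ β →
      ∀ w ∈ box 4 L, τ / 4 ≤ ‖a β • siteToE w‖ →
        |torusE G r β L (fun U => plane G r p' 0 U * plane G r q' w U) -
            torusE G r β L (plane G r p' 0) * torusE G r β L (plane G r q' w)| ≤ (a β) ^ 8 * |C p' q' η₄| := by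
    intro p' q' hp' hq' hβ' w hw hfar
    have h := hBDD p' q' hp' hq' η₄ hη₄pos β hβ' w hw hfar
    rw [abs_mul, abs_of_pos (pow_pos (inv_pos.2 haβ) 8), inv_pow, ← div_eq_inv_mul,
      div_le_iff₀ (pow_pos haβ 8)] at h
    nlinarith [le_abs_self (C p' q' η₄), pow_pos haβ 8]
  -- thresholds of the four pairs at axis `k`
  have thr : ∀ b : ℝ, |b| ≤ Bs k → b ≤ β := fun b hb => by
    linarith [le_abs_self b, abs_nonneg βa, abs_nonneg βg]
  have aPP := abs_nonneg (β₅ (P k) (P k) η₄); have aQQ := abs_nonneg (β₅ (Q k) (Q k) η₄)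
  have aPQ := abs_nonneg (β₅ (P k) (Q k) η₄); have aQP := abs_nonneg (β₅ (Q k) (P k) η₄)
  have tPP := thr (β₅ (P k) (P k) η₄) (by simp only [hBs]; linarith)
  have tQQ := thr (β₅ (Q k) (Q k) η₄) (by simp only [hBs]; linarith)
  have tPQ := thr (β₅ (P k) (Q k) η₄) (by simp only [hBs]; linarith)
  have tQP := thr (β₅ (Q k) (P k) η₄) (by simp only [hBs]; linarith)
  -- telescoping along the segment, by induction on `n`; the unit step is `abs_cov_sub_succ_axis_le_of_far`
  induction n with
  | zero => simp
  | succ m ih =>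
      have ih' := ih fun j hj => hseg j (by omega)
      obtain ⟨hw1, -, hw3⟩ := hseg m (by omega)
      simp only [box, Fintype.mem_piFinset, Finset.mem_Icc] at hw1
      have e : z + (Pi.single k (((m + 1 : ℕ)) : ℤ) : Site 4) = z + Pi.single k (m : ℤ) + Pi.single k 1 := by
        rw [Nat.cast_succ, Pi.single_add, add_assoc]
      rw [e]
      have key := abs_cov_sub_succ_axis_le_of_far G r hβ0 hL1 hp hq k haβ haτ8 ha1 haL
        (far (P k) (P k) (hPv k) (hPv k) tPP) (far (Q k) (Q k) (hQv k) (hQv k) tQQ)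
        (far (P k) (Q k) (hPv k) (hQv k) tPQ) (far (Q k) (P k) (hQv k) (hPv k) tQP)
        (z + Pi.single k (m : ℤ)) hw1 (by rw [Pi.add_apply, Pi.single_eq_same]; push_cast; exact hw3)
      have key' := key.trans_eq (show 12 * (a β / τ) * ((a β) ^ 8 * |C (P k) (P k) η₄| +
          (a β) ^ 8 * |C (Q k) (Q k) η₄| + 2 * ((a β) ^ 8 * |C (P k) (Q k) η₄|) + 2 * ((a β) ^ 8 * |C (Q k) (P k) η₄|)) =
            12 / τ * Cs k * a β * (a β) ^ 8 by simp only [hCs]; ring)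
      have h1 : 12 / τ * Cs k ≤ 12 / τ * ∑ k', Cs k' := mul_le_mul_of_nonneg_left hCsum (by positivity)
      have h2 : 0 ≤ a β * (a β) ^ 8 := by positivity
      have step : |(a β)⁻¹ ^ 8 * (torusE G r β L (fun U => plane G r p 0 U * plane G r q (z + Pi.single k (m : ℤ)) U) -
            torusE G r β L (plane G r p 0) * torusE G r β L (plane G r q (z + Pi.single k (m : ℤ)))) -
          (a β)⁻¹ ^ 8 * (torusE G r β L (fun U => plane G r p 0 U *
              plane G r q (z + Pi.single k (m : ℤ) + Pi.single k 1) U) -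
            torusE G r β L (plane G r p 0) *
              torusE G r β L (plane G r q (z + Pi.single k (m : ℤ) + Pi.single k 1)))| ≤
          12 / τ * (∑ k', Cs k') * a β := by
        rw [← mul_sub, abs_mul, abs_of_pos (pow_pos (inv_pos.2 haβ) 8), inv_pow, ← div_eq_inv_mul,
          div_le_iff₀ (pow_pos haβ 8)]
        refine key'.trans ?_
        nlinarith
      have comb := (abs_sub_le _ _ _).trans (add_le_add ih' step)
      refine comb.trans (le_of_eq ?_)
      push_cast
      ring

end Summit.QuantumFields.YangMills.Cruxes.FixedTorusFirstEngineTori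

end
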